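import Mathlib
import Literature.NumberTheory.LFunctions.WeilMarkovQuadratic
import Literature.NumberTheory.LFunctions.WeilArchimedeanPositivityProofs
import Literature.NumberTheory.LFunctions.WeilWindowSuzukiProofs
import HarnessLib

/-!
# Stub `stub_incrementAverage` — the increment average on the doubled window
(crux `WeilParity.EvenWinsArch`, stmt-RiemannHypothesis-15433, line `birth`)

For a Weil test function `g` (smooth, compactly supported) with `tsupport g ⊆ [-R, R]`, `0 < R`,
the increment form `D_u(g) = ∫ ‖g(x + u) − g(x)‖² dx` (`weilIncrement`) is integrable on the
doubled window `(0, 2R]` and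

  `∫_{(0, 2R]} D_u(g) du ≤ 4R ‖g‖₂²`.

Proof. `u ↦ D_u(g)` is continuous (`continuous_weilIncrement`: it is
`2‖g‖₂² − Re k(u) − Re k(−u)` for the smooth kernel `k = g ⋆ g̃`), hence integrable on the bounded
interval. The set integral over `Ioc 0 (2R)` is the interval integral `∫₀^{2R}`, which the tree
evaluates as `4R‖g‖₂² − |∫ g|²` (`intervalIntegral_weilIncrement`: `∫_{−2R}^{2R} k = ∫ k = |∫ g|²`
since `tsupport k ⊆ [−2R, 2R]`), and `|∫ g|² ≥ 0`.
-/

noncomputable section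

set_option linter.dupNamespace false

open MeasureTheory Set

namespace Summit.RiemannHypothesis.RiemannHypothesis.Theorems.WeilParity.EvenWinsArch

open Literature.NumberTheory.LFunctions

/-- **The increment average.** For a test function `g` supported in `[-R, R]` (`0 < R`),
`u ↦ D_u(g) = ∫ ‖g(x+u) − g(x)‖² dx` is integrable on `(0, 2R]` and
`∫_{(0,2R]} D_u(g) du ≤ 4R ‖g‖₂²` (indeed `= 4R‖g‖₂² − |∫ g|²`, `intervalIntegral_weilIncrement`). -/
theorem stub_incrementAverage :
    ∀ (g : ℝ → ℂ) (R : ℝ), Literature.NumberTheory.LFunctions.IsWeilTest g →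
      tsupport g ⊆ Set.Icc (-R) R → 0 < R →
      MeasureTheory.IntegrableOn (Literature.NumberTheory.LFunctions.weilIncrement g) (Set.Ioc 0 (2 * R)) ∧
        ∫ u in Set.Ioc (0 : ℝ) (2 * R), Literature.NumberTheory.LFunctions.weilIncrement g u ≤
          4 * R * ∫ x : ℝ, ‖g x‖ ^ 2 := by
  intro g R hg hsupp hR
  refine ⟨(continuous_weilIncrement hg).integrableOn_Ioc, ?_⟩
  rw [← intervalIntegral.integral_of_le (by linarith : (0 : ℝ) ≤ 2 * R),
    intervalIntegral_weilIncrement hg hR.le hsupp]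
  linarith [sq_nonneg ‖∫ x : ℝ, g x‖]

end Summit.RiemannHypothesis.RiemannHypothesis.Theorems.WeilParity.EvenWinsArch

end
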